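import Literature.Computability.Cryptography.FpGoldreichLevinDirectProduct
import Mathlib.Logic.Equiv.Fin.Basic
import HarnessLib

/-!
# The von Neumann trick and the predictor for `g^{GL}` over `𝔽_p` (CIKK §4.2)

Groundwork for the named fact `Literature.Computability.Learning.cikk_learn_AC0Mod` (CIKK 2016,
Cor. 5.4) for odd primes `p`: the Boolean-isation of an `𝔽_p`-valued hard function by von
Neumann's trick (CIKK Def. 4.5), its bias (Claim 4.6) as an EXACT count, and the chain of
CIKK Thm. 4.7 (predictor → distinguisher → hybrid argument → predictor over `𝔽_p`) in exact
counting form over explicit finite coin spaces: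

* `vnL`, `vnE`, `vnE_swapAll`, `two_mul_card_vnE_true`, `card_vnE_le` — von Neumann's function
  on `T` pairs and `|#{E^{vN} = b} - p^{2T}/2| ≤ p^T/2` (Claim 4.6, exact);
* `pairUp`, `vnE2` — the same function on a flat vector of `2T` field elements;
* `hybLab`, `vnPred` — the hybrid labels and the predictor
  `C(σ) = if h₁(w[m ↦ σ]) = E^{vN}(hyb_m[m ↦ u]) then u else u'` built from a predictor `h₁` of
  `E^{vN} ∘ G^{2T}` and the coins `(m, w, a, u, u')`;
* **`vnPred_count`** — if `h₁` agrees with `E^{vN}(G(w₁), …, G(w_{2T}))` on a `1/2 + η`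
  fraction of the `w`, then averaged over the coins the predictor computes `G` with probability
  `≥ 1/p + (η - p^{-T}/2)/(2Tp)`; **`card_goodVNCoins_ge`** — hence for a `μ/2` fraction of the
  coins it has agreement `≥ 1/p + μ/2` (`μ = (η - p^{-T}/2)/(2Tp)`).

## References

* M. Carmosino, R. Impagliazzo, V. Kabanets, A. Kolokolova, *Learning algorithms from natural
  proofs*, CCC 2016, Def. 4.5, Claim 4.6, Thm. 4.7, Thm. 4.8
  [CarmosinoImpagliazzoKabanetsKolokolova2016].
* J. von Neumann, *Various techniques used in connection with random digits*, 1951 [folklore].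
-/

namespace Literature.Computability.Cryptography

open Finset Function

variable {p : ℕ} [hp : Fact p.Prime]

/-! ### von Neumann's trick (CIKK Def. 4.5) -/

/-- von Neumann's function on a list of pairs: the first unequal pair `(a, b)` decides (`1` iff
`a > b`), all pairs equal gives `1`. [cite: CarmosinoImpagliazzoKabanetsKolokolova2016, Def. 4.5] -/
def vnL : List (ZMod p × ZMod p) → Bool
  | [] => true
  | ab :: l => if ab.1 = ab.2 then vnL l else decide (ab.2.val < ab.1.val)

/-- Swapping every pair negates von Neumann's function unless all pairs are equal. [folklore] -/
theorem vnL_map_swap (l : List (ZMod p × ZMod p)) :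
    vnL (l.map Prod.swap) = if l.all (fun ab => decide (ab.1 = ab.2)) then true else !vnL l := by
  induction l with
  | nil => rfl
  | cons ab l ih =>
      obtain ⟨a, b⟩ := ab
      by_cases hab : a = b
      · subst hab
        simp only [List.map_cons, Prod.swap_prod_mk, vnL, if_true, List.all_cons, decide_true,
          Bool.true_and]
        exact ih
      · have hba : ¬ b = a := fun h => hab h.symm
        have hv : a.val ≠ b.val := fun h => hab (ZMod.val_injective p h)
        have hiff : a.val < b.val ↔ ¬ b.val < a.val := by omega
        simp only [List.map_cons, Prod.swap_prod_mk, vnL, hba, if_false, List.all_cons, hab,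
          decide_false, Bool.false_and]
        rw [Bool.eq_iff_iff]
        simp [hiff]

variable (T : ℕ)

/-- `E^{vN}` on `T` pairs. [cite: CarmosinoImpagliazzoKabanetsKolokolova2016, Def. 4.5] -/
def vnE (ā : Fin T → ZMod p × ZMod p) : Bool := vnL (List.ofFn ā)

/-- All pairs equal. [folklore] -/
def AllEq (ā : Fin T → ZMod p × ZMod p) : Prop := ∀ j, (ā j).1 = (ā j).2

/-- All-equal is decidable. [folklore] -/
instance (ā : Fin T → ZMod p × ZMod p) : Decidable (AllEq T ā) := by unfold AllEq; infer_instance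

/-- Swap every pair. [folklore] -/
def swapAll (ā : Fin T → ZMod p × ZMod p) : Fin T → ZMod p × ZMod p := fun j => (ā j).swap

omit hp in
/-- Swapping twice is the identity. [folklore] -/
theorem swapAll_swapAll (ā : Fin T → ZMod p × ZMod p) : swapAll T (swapAll T ā) = ā := by
  funext j; simp [swapAll]

omit hp in
/-- Swapping preserves all-equality. [folklore] -/
theorem allEq_swapAll (ā : Fin T → ZMod p × ZMod p) : AllEq T (swapAll T ā) ↔ AllEq T ā := by
  unfold AllEq swapAll; exact forall_congr' fun j => by simp [eq_comm]

omit hp in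
/-- If all pairs are equal the value is `1`. [cite: CarmosinoImpagliazzoKabanetsKolokolova2016, Def. 4.5] -/
theorem vnE_of_allEq {ā : Fin T → ZMod p × ZMod p} (h : AllEq T ā) : vnE T ā = true := by
  unfold vnE
  suffices hl : ∀ l : List (ZMod p × ZMod p), (∀ ab ∈ l, ab.1 = ab.2) → vnL l = true by
    exact hl _ fun ab hab => by
      obtain ⟨j, rfl⟩ := List.mem_ofFn.1 hab
      exact h j
  intro l hl
  induction l with
  | nil => rfl
  | cons ab l ih =>
      simp only [vnL, hl ab (by simp), if_true]
      exact ih fun ab' h' => hl ab' (by simp [h'])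

/-- **Swapping every pair negates `E^{vN}` unless all pairs are equal.** [cite: CarmosinoImpagliazzoKabanetsKolokolova2016, Claim 4.6 (proof: "conditioned on having some unequal pair … the bias is 0")] -/
theorem vnE_swapAll (ā : Fin T → ZMod p × ZMod p) (h : ¬ AllEq T ā) : vnE T (swapAll T ā) = !vnE T ā := by
  unfold vnE
  have hmap : List.ofFn (swapAll T ā) = (List.ofFn ā).map Prod.swap := by
    rw [List.map_ofFn]; rfl
  rw [hmap, vnL_map_swap]
  have hall : ¬ ((List.ofFn ā).all fun ab => decide (ab.1 = ab.2)) = true := by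
    rw [List.all_eq_true]
    intro hall
    exact h fun j => by simpa using hall (ā j) (List.mem_ofFn.2 ⟨j, rfl⟩)
  simp [hall]

/-- The number of all-equal sequences is `p^T`. [cite: CarmosinoImpagliazzoKabanetsKolokolova2016, Claim 4.6 (proof: "the probability of having collisions in all `t` independent samples … is `p^{-t}`")] -/
theorem card_allEq : (univ.filter fun ā : Fin T → ZMod p × ZMod p => AllEq T ā).card = p ^ T := by
  classical
  have h : (univ.filter fun ā : Fin T → ZMod p × ZMod p => AllEq T ā) =
      (univ : Finset (Fin T → ZMod p)).map ⟨fun a j => (a j, a j), fun a b hab => by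
        funext j; exact congrArg (fun f => (f j).1) hab⟩ := by
    ext ā
    simp only [mem_filter, mem_univ, true_and, mem_map, Function.Embedding.coeFn_mk]
    constructor
    · intro hā; exact ⟨fun j => (ā j).1, funext fun j => Prod.ext rfl (hā j)⟩
    · rintro ⟨a, rfl⟩ j; rfl
  rw [h, card_map, card_univ, Fintype.card_fun, Fintype.card_fin, ZMod.card]

/-- The `0`-outputs are in bijection (swap) with the `1`-outputs that are not all-equal. [cite: CarmosinoImpagliazzoKabanetsKolokolova2016, Claim 4.6 (proof)] -/
theorem card_vnE_false_eq :
    (univ.filter fun ā : Fin T → ZMod p × ZMod p => vnE T ā = false).card =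
      (univ.filter fun ā : Fin T → ZMod p × ZMod p => ¬ AllEq T ā ∧ vnE T ā = true).card := by
  classical
  refine Finset.card_bij (fun ā _ => swapAll T ā) ?_ ?_ ?_
  · intro ā hā
    have hf := (mem_filter.1 hā).2
    have hne : ¬ AllEq T ā := fun h => by rw [vnE_of_allEq T h] at hf; exact Bool.noConfusion hf
    refine mem_filter.2 ⟨mem_univ _, (allEq_swapAll T ā).not.2 hne, ?_⟩
    rw [vnE_swapAll T ā hne, hf]; rfl
  · intro ā _ bb _ h
    rw [← swapAll_swapAll T ā, h, swapAll_swapAll]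
  · intro bb hb
    obtain ⟨hne, ht⟩ := (mem_filter.1 hb).2
    refine ⟨swapAll T bb, mem_filter.2 ⟨mem_univ _, ?_⟩, swapAll_swapAll T bb⟩
    rw [vnE_swapAll T bb hne, ht]; rfl

/-- **Claim 4.6, exact form**: `2 · #{E^{vN} = 1} = p^{2T} + p^T`. [cite: CarmosinoImpagliazzoKabanetsKolokolova2016, Claim 4.6] -/
theorem two_mul_card_vnE_true :
    2 * (univ.filter fun ā : Fin T → ZMod p × ZMod p => vnE T ā = true).card = p ^ (2 * T) + p ^ T := by
  classical
  have htot : (univ.filter fun ā : Fin T → ZMod p × ZMod p => vnE T ā = true).card +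
      (univ.filter fun ā : Fin T → ZMod p × ZMod p => vnE T ā = false).card = p ^ (2 * T) := by
    have h := Finset.card_filter_add_card_filter_not (s := (univ : Finset (Fin T → ZMod p × ZMod p)))
      (fun ā => vnE T ā = true)
    have hneg : (univ.filter fun ā : Fin T → ZMod p × ZMod p => ¬ vnE T ā = true) =
        (univ.filter fun ā : Fin T → ZMod p × ZMod p => vnE T ā = false) :=
      filter_congr fun ā _ => by simp
    rw [hneg, card_univ, Fintype.card_fun, Fintype.card_fin, Fintype.card_prod, ZMod.card] at h
    rw [h, pow_mul]; ring
  have hsplit : (univ.filter fun ā : Fin T → ZMod p × ZMod p => vnE T ā = true).card =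
      (univ.filter fun ā : Fin T → ZMod p × ZMod p => AllEq T ā).card +
      (univ.filter fun ā : Fin T → ZMod p × ZMod p => ¬ AllEq T ā ∧ vnE T ā = true).card := by
    rw [← Finset.card_filter_add_card_filter_not (s := univ.filter fun ā : Fin T → ZMod p × ZMod p => vnE T ā = true)
      (fun ā => AllEq T ā), filter_filter, filter_filter]
    congr 1
    · congr 1; exact filter_congr fun ā _ => ⟨fun h => h.2, fun h => ⟨vnE_of_allEq T h, h⟩⟩
    · congr 1; exact filter_congr fun ā _ => ⟨fun h => ⟨h.2, h.1⟩, fun h => ⟨h.2, h.1⟩⟩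
  rw [card_allEq, ← card_vnE_false_eq] at hsplit
  omega

/-- **Claim 4.6, as a bound**: `#{E^{vN} = b} ≤ (p^{2T} + p^T)/2` for both values `b`. [cite: CarmosinoImpagliazzoKabanetsKolokolova2016, Claim 4.6] -/
theorem card_vnE_le (b : Bool) :
    ((univ.filter fun ā : Fin T → ZMod p × ZMod p => vnE T ā = b).card : ℝ) ≤ ((p : ℝ) ^ (2 * T) + p ^ T) / 2 := by
  classical
  have h2 := two_mul_card_vnE_true (p := p) T
  have htot : (univ.filter fun ā : Fin T → ZMod p × ZMod p => vnE T ā = true).card +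
      (univ.filter fun ā : Fin T → ZMod p × ZMod p => vnE T ā = false).card = p ^ (2 * T) := by
    have h := Finset.card_filter_add_card_filter_not (s := (univ : Finset (Fin T → ZMod p × ZMod p)))
      (fun ā => vnE T ā = true)
    have hneg : (univ.filter fun ā : Fin T → ZMod p × ZMod p => ¬ vnE T ā = true) =
        (univ.filter fun ā : Fin T → ZMod p × ZMod p => vnE T ā = false) :=
      filter_congr fun ā _ => by simp
    rw [hneg, card_univ, Fintype.card_fun, Fintype.card_fin, Fintype.card_prod, ZMod.card] at h
    rw [h, pow_mul]; ring
  cases b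
  · have hf : ((univ.filter fun ā : Fin T → ZMod p × ZMod p => vnE T ā = false).card : ℝ) * 2 =
        (p : ℝ) ^ (2 * T) - p ^ T := by
      have e1 : (((univ.filter fun ā : Fin T → ZMod p × ZMod p => vnE T ā = true).card +
          (univ.filter fun ā : Fin T → ZMod p × ZMod p => vnE T ā = false).card : ℕ) : ℝ) = (p : ℝ) ^ (2 * T) := by
        exact_mod_cast htot
      have e2 : ((2 * (univ.filter fun ā : Fin T → ZMod p × ZMod p => vnE T ā = true).card : ℕ) : ℝ) =
          (p : ℝ) ^ (2 * T) + p ^ T := by exact_mod_cast h2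
      push_cast at e1 e2
      linarith
    have hT : (0 : ℝ) ≤ (p : ℝ) ^ T := by positivity
    linarith
  · have e2 : ((2 * (univ.filter fun ā : Fin T → ZMod p × ZMod p => vnE T ā = true).card : ℕ) : ℝ) =
        (p : ℝ) ^ (2 * T) + p ^ T := by exact_mod_cast h2
    push_cast at e2
    linarith

/-! ### The flat version on `2T` field elements -/

/-- Pairing up a flat vector of `T·2` field elements. [folklore] -/
def pairUp : (Fin (T * 2) → ZMod p) ≃ (Fin T → ZMod p × ZMod p) :=
  ((Equiv.arrowCongr finProdFinEquiv (Equiv.refl (ZMod p))).symm.trans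
    ((Equiv.curry (Fin T) (Fin 2) (ZMod p)).trans
      (Equiv.arrowCongr (Equiv.refl (Fin T)) (finTwoArrowEquiv (ZMod p)))))

omit hp in
/-- The `j`-th pair of a flat vector. [folklore] -/
theorem pairUp_apply (a : Fin (T * 2) → ZMod p) (j : Fin T) :
    pairUp T a j = (a (finProdFinEquiv (j, 0)), a (finProdFinEquiv (j, 1))) := rfl

/-- `E^{vN}` on a flat vector `(a₁, b₁, a₂, b₂, …)`. [cite: CarmosinoImpagliazzoKabanetsKolokolova2016, Def. 4.5] -/
def vnE2 (a : Fin (T * 2) → ZMod p) : Bool := vnE T (pairUp T a)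

omit hp in
/-- Counting along an equivalence. [folklore] -/
theorem card_filter_comp_equiv {γ δ : Type*} [Fintype γ] [Fintype δ] (e : γ ≃ δ) (P : δ → Prop) [DecidablePred P] :
    (univ.filter fun c : γ => P (e c)).card = (univ.filter fun d : δ => P d).card := by
  refine Finset.card_bij (fun c _ => e c) (fun c hc => by simpa using hc) (fun c₁ _ c₂ _ h => e.injective h)
    (fun d hd => ⟨e.symm d, by simpa using hd, by simp⟩)

/-- Claim 4.6 for the flat version. [cite: CarmosinoImpagliazzoKabanetsKolokolova2016, Claim 4.6] -/
theorem card_vnE2_le (b : Bool) :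
    ((univ.filter fun a : Fin (T * 2) → ZMod p => vnE2 T a = b).card : ℝ) ≤ ((p : ℝ) ^ (2 * T) + p ^ T) / 2 := by
  classical
  have h := card_filter_comp_equiv (pairUp (p := p) T) (fun ā => vnE T ā = b)
  unfold vnE2
  rw [h]
  exact card_vnE_le T b

/-! ### The predictor for `G` (CIKK Thm. 4.7, constructive direction, exact counting) -/

section Chain

variable {T}
variable {S : Type*} (G : S → ZMod p) (h₁ : (Fin (T * 2) → S) → Bool)

/-- The real labels `(G(w_c))_c`. [cite: CarmosinoImpagliazzoKabanetsKolokolova2016, Thm. 4.7 (proof, `g^{GL}(𝒟)^{2t}`)] -/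
def realLab (w : Fin (T * 2) → S) : Fin (T * 2) → ZMod p := fun c => G (w c)

/-- The hybrid labels: real below `m`, ideal from `m` on. [cite: CarmosinoImpagliazzoKabanetsKolokolova2016, Thm. 4.7 (proof, step 2: hybrid argument)] -/
def hybLab (m : ℕ) (w : Fin (T * 2) → S) (a : Fin (T * 2) → ZMod p) : Fin (T * 2) → ZMod p :=
  fun c => if (c : ℕ) < m then G (w c) else a c

omit hp in
/-- Hybrid `0` is all ideal. [folklore] -/
theorem hybLab_zero (w : Fin (T * 2) → S) (a : Fin (T * 2) → ZMod p) : hybLab G 0 w a = a := by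
  funext c; simp [hybLab]

omit hp in
/-- Hybrid `2T` is all real. [folklore] -/
theorem hybLab_top (w : Fin (T * 2) → S) (a : Fin (T * 2) → ZMod p) : hybLab G (T * 2) w a = realLab G w := by
  funext c; simp [hybLab, realLab, c.isLt]

omit hp in
/-- Setting coordinate `m` of hybrid `m` to the real label gives hybrid `m+1`. [folklore] -/
theorem update_hybLab_real (m : Fin (T * 2)) (w : Fin (T * 2) → S) (a : Fin (T * 2) → ZMod p) :
    update (hybLab G m w a) m (G (w m)) = hybLab G (m + 1) w a := by
  funext c
  by_cases hc : c = m
  · subst hc; simp [hybLab]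
  · have hc' : (c : ℕ) ≠ m := fun h => hc (Fin.ext h)
    rw [update_of_ne hc]
    simp only [hybLab]
    have : ((c : ℕ) < m) ↔ ((c : ℕ) < m + 1) := by omega
    simp only [this]

omit hp in
/-- Setting coordinate `m` of hybrid `m` to `u` is hybrid `m` with the ideal label `u`. [folklore] -/
theorem update_hybLab_ideal (m : Fin (T * 2)) (w : Fin (T * 2) → S) (a : Fin (T * 2) → ZMod p) (u : ZMod p) :
    update (hybLab G m w a) m u = hybLab G m w (update a m u) := by
  funext c
  by_cases hc : c = m
  · subst hc; simp [hybLab]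
  · rw [update_of_ne hc]
    simp only [hybLab, update_of_ne hc]

omit hp in
/-- Hybrid `m` does not read block `m`. [folklore] -/
theorem hybLab_update_w (m : Fin (T * 2)) (w : Fin (T * 2) → S) (a : Fin (T * 2) → ZMod p) (σ : S) :
    hybLab G m (update w m σ) a = hybLab G m w a := by
  funext c
  by_cases hc : c = m
  · subst hc; simp [hybLab]
  · simp only [hybLab, update_of_ne hc]

/-- The coins of the von Neumann stage: hybrid index `m`, filler blocks `w`, ideal labels `a`,
the guessed value `u` and the fallback value `u'`. [cite: CarmosinoImpagliazzoKabanetsKolokolova2016, Thm. 4.7 (proof: "an efficient randomized algorithm … for going in the reverse direction")] -/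
abbrev VNCoins (S' : Type*) (T' p' : ℕ) : Type _ :=
  Fin (T' * 2) × (Fin (T' * 2) → S') × (Fin (T' * 2) → ZMod p') × ZMod p' × ZMod p'

/-- The single-coordinate test `T₃(σ, v) = [h₁(w[m ↦ σ]) = E^{vN}(hyb_m[m ↦ v])]`. [cite: CarmosinoImpagliazzoKabanetsKolokolova2016, Thm. 4.7 (proof, steps 2–3)] -/
def vnTest (m : Fin (T * 2)) (w : Fin (T * 2) → S) (a : Fin (T * 2) → ZMod p) (σ : S) (v : ZMod p) : Bool :=
  decide (h₁ (update w m σ) = vnE2 T (update (hybLab G m w a) m v))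

/-- **The predictor for `G`** (distinguisher → predictor): `C(σ) = u` if the test accepts `(σ, u)`,
else `u'`. [cite: CarmosinoImpagliazzoKabanetsKolokolova2016, Thm. 4.7 (proof, step 1: "unpredictable ⇒ indistinguishable", reversed)] -/
def vnPred (c : VNCoins S T p) (σ : S) : ZMod p :=
  if vnTest G h₁ c.1 c.2.1 c.2.2.1 σ c.2.2.2.1 then c.2.2.2.1 else c.2.2.2.2

omit hp in
/-- **Re-randomising one coordinate**: `Σ_{w, σ} F(w[m ↦ σ], σ) = |α| · Σ_w F(w, w_m)`. [folklore] -/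
theorem sum_sum_update {ι α : Type*} [Fintype ι] [DecidableEq ι] [Fintype α] (m : ι) (F : (ι → α) → α → ℝ) :
    ∑ w : ι → α, ∑ σ : α, F (update w m σ) σ = Fintype.card α * ∑ w : ι → α, F w (w m) := by
  classical
  let Φ : (ι → α) × α ≃ (ι → α) × α :=
    { toFun := fun q => (update q.1 m q.2, q.1 m)
      invFun := fun q => (update q.1 m q.2, q.1 m)
      left_inv := fun q => by simp
      right_inv := fun q => by simp }
  calc ∑ w : ι → α, ∑ σ : α, F (update w m σ) σ
      = ∑ q : (ι → α) × α, F (Φ q).1 ((Φ q).1 m) := by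
        rw [Fintype.sum_prod_type]; simp [Φ]
    _ = ∑ q : (ι → α) × α, F q.1 (q.1 m) := Φ.sum_comp (fun q => F q.1 (q.1 m))
    _ = ∑ w : ι → α, ∑ _σ : α, F w (w m) := Fintype.sum_prod_type _
    _ = Fintype.card α * ∑ w : ι → α, F w (w m) := by
        rw [Finset.mul_sum]
        exact Finset.sum_congr rfl fun w _ => by rw [Finset.sum_const, card_univ, nsmul_eq_mul]

/-- The distinguisher-to-predictor count for one query: summing over the guessed and fallback
values. [cite: CarmosinoImpagliazzoKabanetsKolokolova2016, Thm. 4.7 (proof, step 1)] -/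
theorem sum_guess_fallback (t : ZMod p → Bool) (g : ZMod p) :
    ∑ u : ZMod p, ∑ u' : ZMod p, (if (if t u then u else u') = g then (1 : ℝ) else 0) +
      ∑ u : ZMod p, (if t u then (1 : ℝ) else 0) = p * (if t g then (1 : ℝ) else 0) + p := by
  classical
  have hpt : ∀ u : ZMod p, (∑ u' : ZMod p, (if (if t u then u else u') = g then (1 : ℝ) else 0)) +
      (if t u then (1 : ℝ) else 0) = (if u = g then (p : ℝ) * (if t u then (1 : ℝ) else 0) else 0) + 1 := by
    intro u
    by_cases hug : u = g
    · subst hug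
      cases htu : t u <;> simp
    · cases htu : t u <;> simp [hug]
  rw [← Finset.sum_add_distrib, Finset.sum_congr rfl fun u _ => hpt u, Finset.sum_add_distrib]
  simp

section Fin
variable [Fintype S]

/-- The hybrid agreement `Φ(m) = #{(w, a) : h₁(w) = E^{vN}(hyb_m(w, a))}`. [cite: CarmosinoImpagliazzoKabanetsKolokolova2016, Thm. 4.7 (proof, step 2)] -/
noncomputable def hybAgree (m : ℕ) : ℝ :=
  ∑ w : Fin (T * 2) → S, ∑ a : Fin (T * 2) → ZMod p, (if h₁ w = vnE2 T (hybLab G m w a) then (1 : ℝ) else 0)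

/-- The count for fixed `(m, w, a)`: `Σ_{u, u', σ} [C(σ) = G(σ)] = p·A + p·|S| - B`. [cite: CarmosinoImpagliazzoKabanetsKolokolova2016, Thm. 4.7 (proof, step 1)] -/
theorem sum_vnPred_fixed (m : Fin (T * 2)) (w : Fin (T * 2) → S) (a : Fin (T * 2) → ZMod p) :
    ∑ u : ZMod p, ∑ u' : ZMod p, ∑ σ : S, (if vnPred G h₁ (m, w, a, u, u') σ = G σ then (1 : ℝ) else 0) =
      p * ∑ σ : S, (if vnTest G h₁ m w a σ (G σ) then (1 : ℝ) else 0) + p * Fintype.card S -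
        ∑ σ : S, ∑ u : ZMod p, (if vnTest G h₁ m w a σ u then (1 : ℝ) else 0) := by
  have hcomm : ∑ u : ZMod p, ∑ u' : ZMod p, ∑ σ : S, (if vnPred G h₁ (m, w, a, u, u') σ = G σ then (1 : ℝ) else 0) =
      ∑ σ : S, ∑ u : ZMod p, ∑ u' : ZMod p, (if (if vnTest G h₁ m w a σ u then u else u') = G σ then (1 : ℝ) else 0) :=
    calc ∑ u : ZMod p, ∑ u' : ZMod p, ∑ σ : S, (if vnPred G h₁ (m, w, a, u, u') σ = G σ then (1 : ℝ) else 0)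
        = ∑ u : ZMod p, ∑ σ : S, ∑ u' : ZMod p, (if (if vnTest G h₁ m w a σ u then u else u') = G σ then (1 : ℝ) else 0) :=
          Finset.sum_congr rfl fun u _ => Finset.sum_comm
      _ = _ := Finset.sum_comm
  rw [hcomm]
  have hσ : ∀ σ : S, ∑ u : ZMod p, ∑ u' : ZMod p, (if (if vnTest G h₁ m w a σ u then u else u') = G σ then (1 : ℝ) else 0) =
      p * (if vnTest G h₁ m w a σ (G σ) then (1 : ℝ) else 0) + p - ∑ u : ZMod p, (if vnTest G h₁ m w a σ u then (1 : ℝ) else 0) := by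
    intro σ
    have h := sum_guess_fallback (fun u => vnTest G h₁ m w a σ u) (G σ)
    linarith
  rw [Finset.sum_congr rfl fun σ _ => hσ σ, Finset.sum_sub_distrib, Finset.sum_add_distrib, ← Finset.mul_sum,
    Finset.sum_const, card_univ, nsmul_eq_mul]
  ring

/-- `Σ_{w, a} A = |S| · Φ(m+1)`. [cite: CarmosinoImpagliazzoKabanetsKolokolova2016, Thm. 4.7 (proof, step 2)] -/
theorem sum_vnTest_real (m : Fin (T * 2)) :
    ∑ w : Fin (T * 2) → S, ∑ a : Fin (T * 2) → ZMod p, ∑ σ : S, (if vnTest G h₁ m w a σ (G σ) then (1 : ℝ) else 0) =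
      Fintype.card S * hybAgree G h₁ ((m : ℕ) + 1) := by
  classical
  calc ∑ w : Fin (T * 2) → S, ∑ a : Fin (T * 2) → ZMod p, ∑ σ : S, (if vnTest G h₁ m w a σ (G σ) then (1 : ℝ) else 0)
      = ∑ a : Fin (T * 2) → ZMod p, ∑ w : Fin (T * 2) → S, ∑ σ : S,
          (if h₁ (update w m σ) = vnE2 T (update (hybLab G m (update w m σ) a) m (G σ)) then (1 : ℝ) else 0) := by
        rw [Finset.sum_comm]
        refine Finset.sum_congr rfl fun a _ => Finset.sum_congr rfl fun w _ => Finset.sum_congr rfl fun σ _ => ?_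
        simp only [vnTest, hybLab_update_w, decide_eq_true_eq]
    _ = ∑ a : Fin (T * 2) → ZMod p, (Fintype.card S * ∑ w : Fin (T * 2) → S,
          (if h₁ w = vnE2 T (update (hybLab G m w a) m (G (w m))) then (1 : ℝ) else 0)) :=
        Finset.sum_congr rfl fun a _ =>
          sum_sum_update m (fun w' σ => if h₁ w' = vnE2 T (update (hybLab G m w' a) m (G σ)) then (1 : ℝ) else 0)
    _ = ∑ a : Fin (T * 2) → ZMod p, (Fintype.card S * ∑ w : Fin (T * 2) → S,
          (if h₁ w = vnE2 T (hybLab G ((m : ℕ) + 1) w a) then (1 : ℝ) else 0)) := by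
        simp only [update_hybLab_real]
    _ = Fintype.card S * hybAgree G h₁ ((m : ℕ) + 1) := by
        unfold hybAgree
        rw [← Finset.mul_sum]
        congr 1
        exact Finset.sum_comm

/-- `Σ_{w, a} B = p · |S| · Φ(m)`. [cite: CarmosinoImpagliazzoKabanetsKolokolova2016, Thm. 4.7 (proof, step 2)] -/
theorem sum_vnTest_ideal (m : Fin (T * 2)) :
    ∑ w : Fin (T * 2) → S, ∑ a : Fin (T * 2) → ZMod p, ∑ σ : S, ∑ u : ZMod p, (if vnTest G h₁ m w a σ u then (1 : ℝ) else 0) =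
      p * (Fintype.card S * hybAgree G h₁ m) := by
  classical
  have hp' : (Fintype.card (ZMod p) : ℝ) = p := by rw [ZMod.card]
  calc ∑ w : Fin (T * 2) → S, ∑ a : Fin (T * 2) → ZMod p, ∑ σ : S, ∑ u : ZMod p, (if vnTest G h₁ m w a σ u then (1 : ℝ) else 0)
      = ∑ w : Fin (T * 2) → S, ∑ σ : S, ∑ a : Fin (T * 2) → ZMod p, ∑ u : ZMod p,
          (if h₁ (update w m σ) = vnE2 T (hybLab G m w (update a m u)) then (1 : ℝ) else 0) := by
        refine Finset.sum_congr rfl fun w _ => ?_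
        rw [Finset.sum_comm]
        refine Finset.sum_congr rfl fun σ _ => Finset.sum_congr rfl fun a _ => Finset.sum_congr rfl fun u _ => ?_
        simp only [vnTest, update_hybLab_ideal, decide_eq_true_eq]
    _ = ∑ w : Fin (T * 2) → S, ∑ σ : S, ((p : ℝ) * ∑ a : Fin (T * 2) → ZMod p,
          (if h₁ (update w m σ) = vnE2 T (hybLab G m w a) then (1 : ℝ) else 0)) := by
        refine Finset.sum_congr rfl fun w _ => Finset.sum_congr rfl fun σ _ => ?_
        have h := sum_sum_update m (fun a' (_ : ZMod p) => if h₁ (update w m σ) = vnE2 T (hybLab G m w a') then (1 : ℝ) else 0)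
        rw [hp'] at h
        exact h
    _ = ∑ w : Fin (T * 2) → S, ∑ σ : S, ((p : ℝ) * ∑ a : Fin (T * 2) → ZMod p,
          (if h₁ (update w m σ) = vnE2 T (hybLab G m (update w m σ) a) then (1 : ℝ) else 0)) := by
        simp only [hybLab_update_w]
    _ = (p : ℝ) * ∑ w : Fin (T * 2) → S, ∑ σ : S, ∑ a : Fin (T * 2) → ZMod p,
          (if h₁ (update w m σ) = vnE2 T (hybLab G m (update w m σ) a) then (1 : ℝ) else 0) := by
        rw [Finset.mul_sum]
        refine Finset.sum_congr rfl fun w _ => ?_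
        rw [Finset.mul_sum]
    _ = (p : ℝ) * ∑ a : Fin (T * 2) → ZMod p, ∑ w : Fin (T * 2) → S, ∑ σ : S,
          (if h₁ (update w m σ) = vnE2 T (hybLab G m (update w m σ) a) then (1 : ℝ) else 0) := by
        congr 1
        exact (Finset.sum_congr rfl fun w _ => Finset.sum_comm).trans Finset.sum_comm
    _ = (p : ℝ) * ∑ a : Fin (T * 2) → ZMod p, (Fintype.card S * ∑ w : Fin (T * 2) → S,
          (if h₁ w = vnE2 T (hybLab G m w a) then (1 : ℝ) else 0)) := by
        congr 1
        exact Finset.sum_congr rfl fun a _ =>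
          sum_sum_update m (fun w' (_ : S) => if h₁ w' = vnE2 T (hybLab G m w' a) then (1 : ℝ) else 0)
    _ = p * (Fintype.card S * hybAgree G h₁ m) := by
        unfold hybAgree
        congr 1
        rw [← Finset.mul_sum]
        congr 1
        exact Finset.sum_comm

/-- `Φ(2T) = p^{2T} · #{w : h₁(w) = E^{vN}(G(w))}`. [cite: CarmosinoImpagliazzoKabanetsKolokolova2016, Thm. 4.7 (proof)] -/
theorem hybAgree_top :
    hybAgree G h₁ (T * 2) = (p : ℝ) ^ (T * 2) * ((univ.filter fun w : Fin (T * 2) → S => h₁ w = vnE2 T (realLab G w)).card : ℝ) := by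
  classical
  unfold hybAgree
  simp only [hybLab_top, Finset.sum_const, card_univ, nsmul_eq_mul, Fintype.card_fun, Fintype.card_fin, ZMod.card]
  rw [← Finset.mul_sum, natCast_card_filter]
  push_cast; ring

/-- `Φ(0) ≤ |W| · (p^{2T} + p^T)/2` (Claim 4.6). [cite: CarmosinoImpagliazzoKabanetsKolokolova2016, Thm. 4.7 (proof, step 4: "by Claim 4.6")] -/
theorem hybAgree_zero_le :
    hybAgree G h₁ 0 ≤ Fintype.card (Fin (T * 2) → S) * (((p : ℝ) ^ (2 * T) + p ^ T) / 2) := by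
  classical
  unfold hybAgree
  simp only [hybLab_zero]
  calc ∑ w : Fin (T * 2) → S, ∑ a : Fin (T * 2) → ZMod p, (if h₁ w = vnE2 T a then (1 : ℝ) else 0)
      ≤ ∑ _w : Fin (T * 2) → S, (((p : ℝ) ^ (2 * T) + p ^ T) / 2) := by
        refine Finset.sum_le_sum fun w _ => ?_
        rw [show (∑ a : Fin (T * 2) → ZMod p, (if h₁ w = vnE2 T a then (1 : ℝ) else 0)) =
          ((univ.filter fun a : Fin (T * 2) → ZMod p => vnE2 T a = h₁ w).card : ℝ) by
          rw [natCast_card_filter]; exact Finset.sum_congr rfl fun a _ => by simp_rw [eq_comm]]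
        exact card_vnE2_le T (h₁ w)
    _ = Fintype.card (Fin (T * 2) → S) * (((p : ℝ) ^ (2 * T) + p ^ T) / 2) := by
        rw [Finset.sum_const, card_univ, nsmul_eq_mul]

/-- **CIKK Thm. 4.7, constructive direction, exact count.** If `h₁` agrees with
`E^{vN}(G(w₁), …, G(w_{2T}))` on at least a `1/2 + η` fraction of the `w`, then summed over the
coins `(m, w, a, u, u')` and the queries `σ`, the predictor `vnPred` computes `G(σ)` at least
`(1/p + (η - p^{-T}/2)/(2Tp)) · #coins · #queries` times. [cite: CarmosinoImpagliazzoKabanetsKolokolova2016, Thm. 4.7] -/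
theorem vnPred_count (hT : 0 < T) {η : ℝ}
    (hA : (1 / 2 + η) * Fintype.card (Fin (T * 2) → S) ≤
      ((univ.filter fun w : Fin (T * 2) → S => h₁ w = vnE2 T (realLab G w)).card : ℝ)) :
    (1 / p + (η - 1 / (2 * (p : ℝ) ^ T)) / (p * (T * 2 : ℕ))) * (Fintype.card (VNCoins S T p) * Fintype.card S) ≤
      ((univ.filter fun q : VNCoins S T p × S => vnPred G h₁ q.1 q.2 = G q.2).card : ℝ) := by
  classical
  have hpR : (0 : ℝ) < p := by exact_mod_cast hp.out.pos
  have hN : (0 : ℝ) < (T * 2 : ℕ) := by exact_mod_cast (by omega : 0 < T * 2)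
  -- the count as an iterated sum
  have hcount : ((univ.filter fun q : VNCoins S T p × S => vnPred G h₁ q.1 q.2 = G q.2).card : ℝ) =
      ∑ m : Fin (T * 2), ∑ w : Fin (T * 2) → S, ∑ a : Fin (T * 2) → ZMod p,
        ∑ u : ZMod p, ∑ u' : ZMod p, ∑ σ : S, (if vnPred G h₁ (m, w, a, u, u') σ = G σ then (1 : ℝ) else 0) := by
    rw [natCast_card_filter, Fintype.sum_prod_type, Fintype.sum_prod_type]
    refine Finset.sum_congr rfl fun m _ => ?_
    rw [Fintype.sum_prod_type]
    refine Finset.sum_congr rfl fun w _ => ?_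
    rw [Fintype.sum_prod_type]
    refine Finset.sum_congr rfl fun a _ => ?_
    rw [Fintype.sum_prod_type]
  -- abbreviations
  set K : ℝ := p * Fintype.card S * (Fintype.card (Fin (T * 2) → S) * Fintype.card (Fin (T * 2) → ZMod p)) with hK
  set X : ℕ → ℝ := fun i => p * (Fintype.card S * hybAgree G h₁ i) with hX
  -- per `m`
  have hm : ∀ m : Fin (T * 2), ∑ w : Fin (T * 2) → S, ∑ a : Fin (T * 2) → ZMod p,
      ∑ u : ZMod p, ∑ u' : ZMod p, ∑ σ : S, (if vnPred G h₁ (m, w, a, u, u') σ = G σ then (1 : ℝ) else 0) =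
      K + (X ((m : ℕ) + 1) - X m) := by
    intro m
    simp only [sum_vnPred_fixed]
    rw [Finset.sum_congr rfl fun w _ => by rw [Finset.sum_sub_distrib, Finset.sum_add_distrib],
      Finset.sum_sub_distrib, Finset.sum_add_distrib, sum_vnTest_ideal]
    simp only [← Finset.mul_sum]
    rw [sum_vnTest_real]
    simp only [Finset.sum_const, card_univ, nsmul_eq_mul, hK, hX]
    ring
  rw [hcount, Finset.sum_congr rfl fun m _ => hm m, Finset.sum_add_distrib, Finset.sum_const, card_univ,
    Fintype.card_fin, nsmul_eq_mul]
  -- telescope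
  have htel : ∑ m : Fin (T * 2), (X ((m : ℕ) + 1) - X m) = X (T * 2) - X 0 := by
    rw [Fin.sum_univ_eq_sum_range (fun i => X (i + 1) - X i) (T * 2)]
    exact Finset.sum_range_sub X (T * 2)
  rw [htel]
  simp only [hX]
  -- sizes
  have hΛ : (Fintype.card (Fin (T * 2) → ZMod p) : ℝ) = (p : ℝ) ^ T * (p : ℝ) ^ T := by
    rw [Fintype.card_fun, Fintype.card_fin, ZMod.card]; push_cast; rw [← pow_add]; ring_nf
  have hC : (Fintype.card (VNCoins S T p) : ℝ) =
      (T * 2 : ℕ) * (Fintype.card (Fin (T * 2) → S) * (Fintype.card (Fin (T * 2) → ZMod p) * (p * p))) := by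
    simp only [VNCoins, Fintype.card_prod, Fintype.card_fin, ZMod.card]; push_cast; ring
  have htop := hybAgree_top G h₁ (T := T)
  have hzero := hybAgree_zero_le G h₁ (T := T)
  have hpT : (p : ℝ) ^ (T * 2) = (p : ℝ) ^ T * (p : ℝ) ^ T := by rw [← pow_add]; ring_nf
  have hp2T : (p : ℝ) ^ (2 * T) = (p : ℝ) ^ T * (p : ℝ) ^ T := by rw [← pow_add]; ring_nf
  rw [hpT] at htop
  rw [hp2T] at hzero
  have hpTpos : (0 : ℝ) < (p : ℝ) ^ T := by positivity
  rw [hC, hK, hΛ, htop]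
  set PT : ℝ := (p : ℝ) ^ T with hPT
  set W : ℝ := (Fintype.card (Fin (T * 2) → S) : ℝ) with hW
  set CS : ℝ := (Fintype.card S : ℝ) with hCS
  set N : ℝ := ((T * 2 : ℕ) : ℝ) with hNdef
  set AG : ℝ := ((univ.filter fun w : Fin (T * 2) → S => h₁ w = vnE2 T (realLab G w)).card : ℝ) with hAG
  have key : (1 / p + (η - 1 / (2 * PT)) / (p * N)) * (N * (W * (PT * PT * (p * p))) * CS) =
      N * (p * CS * (W * (PT * PT))) + (p * (CS * (PT * PT * ((1 / 2 + η) * W))) - p * (CS * (W * ((PT * PT + PT) / 2)))) := by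
    field_simp; ring
  rw [key]
  have hCS0 : (0 : ℝ) ≤ CS := Nat.cast_nonneg _
  have hpS : (0 : ℝ) ≤ p * CS := by positivity
  have h1 : PT * PT * ((1 / 2 + η) * W) ≤ PT * PT * AG := mul_le_mul_of_nonneg_left hA (by positivity)
  nlinarith [mul_le_mul_of_nonneg_left h1 hpS, mul_le_mul_of_nonneg_left hzero hpS]

/-- **For a noticeable fraction of the coins the predictor is noticeably better than guessing**
(reverse Markov on `vnPred_count`): with `μ = (η - p^{-T}/2)/(2Tp) ≥ 0`, for at least a `μ/2`
fraction of the coins `c`, `vnPred c` agrees with `G` on at least a `1/p + μ/2` fraction of the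
queries. [cite: CarmosinoImpagliazzoKabanetsKolokolova2016, Thm. 4.7] -/
theorem card_goodVNCoins_ge [Nonempty S] (hT : 0 < T) {η : ℝ} (hμ : 0 ≤ (η - 1 / (2 * (p : ℝ) ^ T)) / (p * (T * 2 : ℕ)))
    (hA : (1 / 2 + η) * Fintype.card (Fin (T * 2) → S) ≤
      ((univ.filter fun w : Fin (T * 2) → S => h₁ w = vnE2 T (realLab G w)).card : ℝ)) :
    (η - 1 / (2 * (p : ℝ) ^ T)) / (p * (T * 2 : ℕ)) / 2 * Fintype.card (VNCoins S T p) ≤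
      ((univ.filter fun c : VNCoins S T p =>
        (1 / p + (η - 1 / (2 * (p : ℝ) ^ T)) / (p * (T * 2 : ℕ)) / 2) * Fintype.card S ≤
          ((univ.filter fun σ : S => vnPred G h₁ c σ = G σ).card : ℝ)).card : ℝ) := by
  have hpR : (0 : ℝ) < p := by exact_mod_cast hp.out.pos
  exact card_goodRows_ge_base (A := VNCoins S T p) (B := S) (fun c σ => vnPred G h₁ c σ = G σ)
    (β := 1 / p) (by positivity) hμ (vnPred_count G h₁ hT hA)

end Fin

end Chain

end Literature.Computability.Cryptography
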